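import Summits.AnomalousDissipation.AnomalousDissipation.Theorems.SolenoidalFractalHomogenisationLagrangianStepVmodSfTexts
import Summits.AnomalousDissipation.AnomalousDissipation.Theorems.SolenoidalFractalHomogenisationLagrangianStepVmodSfAssembly
import Summits.AnomalousDissipation.AnomalousDissipation.Theorems.SolenoidalFractalHomogenisationLagrangianStepVmodShortBlock
import Summits.AnomalousDissipation.AnomalousDissipation.Theorems.SolenoidalFractalHomogenisationLagrangianStepVmodConstMode
import Summits.AnomalousDissipation.AnomalousDissipation.Theorems.SolenoidalFractalHomogenisationLagrangianStepVmodCoarseLoss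
import Summits.AnomalousDissipation.AnomalousDissipation.Theorems.SolenoidalFractalHomogenisationLagrangianStepVmodShortPieces
import HarnessLib

/-!
# K1L_D (stmt-AnomalousDissipation-27980): (V_mod) FLAT STAGE — the (sf) block FROM its per-label sideband text: `bsf_of_sfMode`
# (prover ad-k3l-bookkeeping-p1 g10, (sf) owner by tenure RULING D28-5; `--kind proof --supports 27980 --as helper`)

**`bsf_of_sfMode : SFMode_textEVH e → Bsf_textEVH e`** (PROVED, every exponent map `e`).  Given the binders of `Bsf_textEVH e`, take `C₂` from
`SFMode_textEVH e` (`…VmodSfTexts`) and answer with `C₂′ := C_s + C₂/√d_F`, where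
`C_s = 2kΛ/(c·lo) + 2k√(M·W.period·Λ/(c·lo)) + (2/c+1)Λ(hiΛ+β/2)/lo + 16` is ad-k3l g9's short-window constant and
`d_F := 1 − exp(−π²·lo·M·W.period/(32Λ))` the ν-free saturation of the adjoint coarse loss of a FAST test past one period.  Then, at a window
`0 ≤ s < t ≤ Tw` with slow datum `x` and fast test `ζ`:
* SHORT `t − s ≤ M·W.period/ν`: `VmodFlat.short_pairing_le_of_fast` (p715358; `ζ` fast) gives `C_s·√q·√q*`, and the allowance factor is `≥ C₂′ ≥ C_s`
  (`min 1 (P/(t−s)) = 1`);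
* LONG `M·W.period/ν < t − s`: split `x = x₀ + x″` at the zero mode — `x₀` is FIXED by both members (`apply_eq_self_of_supp_zero`, mean conservation),
  `x″` is nonzero-slow; the (sf) ASSEMBLY `abs_inner_sub_le_sqrt_of_slow_sideband` (p716711) on `S = freqBall(n/4) ∖ {0}`, `Z = freqBall(n/4)` with
  `ε_ℓ := η·√(dW_ℓ)` supplied by `SFMode_textEVH` (class-pair preservation of `U`: `PropagatorSymm.fcoeff_apply_eq_zero_of_classes`; `T` a Fourier
  multiplier: `coarseSupp`) gives `|⟪(U−T)x″, ζ⟫| ≤ η·√(Σ_S dW_ℓ‖𝓕x″(ℓ)‖²)·‖ζ‖`; the currencies `Σ_S dW_ℓ‖𝓕x″(ℓ)‖² ≤ q_T(x″) ≤ q_T(x)`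
  (`sum_weight_le_lossFwd`, losses grow) and `d_F·‖ζ‖² ≤ q*_T(ζ)` (`lossAdj_ge_of_supp` at `|k|² ≥ (n/4)²+1 ≥ n²/256`, `ν(t−s) > M·W.period`).
`sorry`-free; NOT a proof of (sf) (the text `SFMode_textEVH` is OPEN: coarse labels via T-I/(V), high labels via W7), of `stub_Vmod_EHT`, of K1L_D
or AD; rung F-D1.A0.
-/

set_option linter.dupNamespace false

noncomputable section

namespace Summit.AnomalousDissipation.AnomalousDissipation.Theorems.SolenoidalFractalHomogenisation.LagrangianStep.VmodFlat

open Literature.Analysis Literature.Analysis.FluidPDE Literature.Analysis.FunctionSpaces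
open MeasureTheory Set Filter UnitAddTorus
open scoped ENNReal NNReal InnerProductSpace
open Summit.AnomalousDissipation.AnomalousDissipation.Theorems.SolenoidalFractalHomogenisation.LagrangianStep.CellClauseMod
open Summit.AnomalousDissipation.AnomalousDissipation.Theorems.SolenoidalFractalHomogenisation.LagrangianStep.LossCurrency
open Summit.AnomalousDissipation.AnomalousDissipation.Theorems.SolenoidalFractalHomogenisation.RealisedQuasiStaticCellLaw
  (isSmooth_cell isDivFree_cell memLp_top_stLift_cell)

/-! ## §1 Arithmetic -/

/-- `n²/256 ≤ (n/4)² + 1` (integer division). [folklore] -/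
theorem sq_div_le_quarter_sq_add_one (n : ℕ) : (n : ℝ) ^ 2 / 256 ≤ (((n / 4 : ℕ) : ℝ)) ^ 2 + 1 := by
  have h3 : (n : ℝ) ≤ 4 * (((n / 4 : ℕ) : ℝ)) + 3 := by
    have h := Nat.div_add_mod n 4
    have hm : n % 4 < 4 := Nat.mod_lt _ (by norm_num)
    have : (n : ℝ) = 4 * (((n / 4 : ℕ) : ℝ)) + ((n % 4 : ℕ) : ℝ) := by exact_mod_cast h.symm
    have hm' : ((n % 4 : ℕ) : ℝ) ≤ 3 := by exact_mod_cast Nat.lt_succ_iff.1 hm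
    linarith
  have hq : (0:ℝ) ≤ ((n / 4 : ℕ) : ℝ) := Nat.cast_nonneg _
  nlinarith [sq_nonneg (((n / 4 : ℕ) : ℝ) - 1), sq_nonneg ((n:ℝ) - 4 * ((n / 4 : ℕ) : ℝ))]

/-- The allowance algebra of the reduction: with `C′ = C_s + C₂/√d`, `0 < d ≤ 1`, `a, m ≥ 0`, `C_s, C₂ ≥ 0`:
`(C₂(C₂a + m))/√d ≤ C′(C′a + m)`. [folklore] -/
theorem allowance_div_sqrt_le {Cs C₂ d a m : ℝ} (hCs : 0 ≤ Cs) (hC₂ : 0 ≤ C₂) (hd : 0 < d) (hd1 : d ≤ 1) (ha : 0 ≤ a) (hm : 0 ≤ m) :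
    C₂ * (C₂ * a + m) / Real.sqrt d ≤ (Cs + C₂ / Real.sqrt d) * ((Cs + C₂ / Real.sqrt d) * a + m) := by
  have hsd : 0 < Real.sqrt d := Real.sqrt_pos.2 hd
  have hsd1 : Real.sqrt d ≤ 1 := by rw [← Real.sqrt_one]; exact Real.sqrt_le_sqrt hd1
  have h1 : C₂ ≤ C₂ / Real.sqrt d := by rw [le_div_iff₀ hsd]; nlinarith
  have h2 : C₂ / Real.sqrt d ≤ Cs + C₂ / Real.sqrt d := by linarith
  have h3 : 0 ≤ C₂ / Real.sqrt d := div_nonneg hC₂ hsd.le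
  rw [div_eq_mul_inv, show C₂ * (C₂ * a + m) * (Real.sqrt d)⁻¹ = (C₂ / Real.sqrt d) * (C₂ * a + m) by ring]
  have h4 : C₂ * a + m ≤ (Cs + C₂ / Real.sqrt d) * a + m := by nlinarith
  calc C₂ / Real.sqrt d * (C₂ * a + m) ≤ C₂ / Real.sqrt d * ((Cs + C₂ / Real.sqrt d) * a + m) :=
        mul_le_mul_of_nonneg_left h4 h3
    _ ≤ (Cs + C₂ / Real.sqrt d) * ((Cs + C₂ / Real.sqrt d) * a + m) :=
        mul_le_mul_of_nonneg_right h2 (by nlinarith)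

/-! ## §2 The reduction -/

set_option maxHeartbeats 3200000 in
/-- **(sf) FROM ITS PER-LABEL SIDEBAND TEXT.**  See the module docstring. -/
theorem bsf_of_sfMode (e : ℝ → ℝ) (h : SFMode_textEVH e) : Bsf_textEVH e := by
  intro k W M hM c hc Φ lo hi Λ β σ C ν₀ K hlo hlo1 hhi hΛ hβ hσ hC hν₀ hν₀1 hK hV hH
  obtain ⟨C₂, hC₂, hmode⟩ := h k W M hM c hc Φ lo hi Λ β σ C ν₀ K hlo hlo1 hhi hΛ hβ hσ hC hν₀ hν₀1 hK hV hH
  have hΛ0 : 0 < Λ := by linarith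
  have hWp : 0 < W.period :=
    Summit.AnomalousDissipation.AnomalousDissipation.Theorems.SolenoidalFractalHomogenisation.PermissibleCarrier.period_pos W
  -- ### the constants
  set Cs : ℝ := 2 * k * Λ / (c * lo) + 2 * k * Real.sqrt (M * W.period * Λ / (c * lo)) + (2 / c + 1) * Λ * (hi * Λ + β / 2) / lo + 16 with hCs
  have hCs0 : 0 ≤ Cs := by rw [hCs]; positivity
  set rF : ℝ := Real.pi ^ 2 * (lo / Λ) * (M * W.period) / 32 with hrF
  have hrF0 : 0 < rF := by rw [hrF]; positivity
  set dF : ℝ := 1 - Real.exp (-rF) with hdF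
  have hdF0 : 0 < dF := by rw [hdF]; have := Real.exp_lt_one_iff.2 (neg_neg_of_pos hrF0); linarith
  have hdF1 : dF ≤ 1 := by rw [hdF]; have := Real.exp_pos (-rF); linarith
  have hsdF : 0 < Real.sqrt dF := Real.sqrt_pos.2 hdF0
  refine ⟨Cs + C₂ / Real.sqrt dF, add_nonneg hCs0 (div_nonneg hC₂ hsdF.le), ?_⟩
  intro ν hν n hn 𝔸 hodd hwin hΦo hΦw Tw hTw U T hU hT s t hs hst htT x ζ hx hζ
  have hν1 : ν ≤ 1 := by linarith [hν.2]
  have hn1 : (1:ℝ) ≤ n := by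
    have h1 : (1:ℝ) ≤ ⌈K / ν⌉₊ := by
      have : 0 < K / ν := div_pos hK hν.1
      exact_mod_cast Nat.one_le_iff_ne_zero.2 (Nat.pos_iff_ne_zero.1 (Nat.ceil_pos.2 this))
    exact h1.trans hn
  have hnpos : 0 < n := by exact_mod_cast (show (0:ℝ) < n by linarith)
  have hn0 : (0:ℝ) < n := by exact_mod_cast hnpos
  have hτ : 0 < t - s := sub_pos.2 hst
  -- the common currency pieces
  set a : ℝ := ν ^ e σ + ((⌈K / ν⌉₊ : ℝ) / n) ^ e σ with ha_def
  set m' : ℝ := (min 1 ((M * W.period / ν) / (t - s))) ^ e σ with hm'_def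
  have ha0 : 0 ≤ a := by
    have h1 : 0 ≤ ν ^ e σ := Real.rpow_nonneg hν.1.le _
    have h2 : 0 ≤ ((⌈K / ν⌉₊ : ℝ) / n) ^ e σ := Real.rpow_nonneg (by positivity) _
    rw [ha_def]; linarith
  have hP0 : 0 ≤ (M * W.period / ν) / (t - s) := div_nonneg (div_nonneg (mul_nonneg hM.le hWp.le) hν.1.le) hτ.le
  have hm'0 : 0 ≤ m' := by rw [hm'_def]; exact Real.rpow_nonneg (le_min zero_le_one hP0) _
  have hTc : ∀ y, ‖T s t y‖ ≤ ‖y‖ := hT.norm_le s t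
  have hq0 : 0 ≤ lossFwd (T s t) x := loss_nonneg hTc x
  have hqs0 : 0 ≤ lossAdj (T s t) ζ := lossAdj_nonneg hTc ζ
  by_cases hshort : t - s ≤ M * W.period / ν
  · -- ### SHORT ROW (ad-k3l g9's `short_pairing_le_of_fast`, test side fast)
    have hS := short_pairing_le_of_fast W M hM hc Φ hlo (by linarith) hΛ.le hβ hν.1 hν1 hnpos hodd hwin hΦo hΦw hU hT hs hst htT
      hshort x ζ (Or.inr hζ)
    refine hS.trans ?_
    have hm'1 : m' = 1 := by
      rw [hm'_def, min_eq_left ((one_le_div hτ).2 hshort), Real.one_rpow]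
    have hfac : Cs ≤ (Cs + C₂ / Real.sqrt dF) * ((Cs + C₂ / Real.sqrt dF) * a + m') := by
      rw [hm'1]
      have h3 : 0 ≤ C₂ / Real.sqrt dF := div_nonneg hC₂ hsdF.le
      nlinarith [mul_nonneg (add_nonneg hCs0 h3) (mul_nonneg (add_nonneg hCs0 h3) ha0)]
    have hqq : 0 ≤ Real.sqrt (lossFwd (T s t) x) * Real.sqrt (lossAdj (T s t) ζ) := by positivity
    calc Cs * Real.sqrt (lossFwd (T s t) x) * Real.sqrt (lossAdj (T s t) ζ)
        = Cs * (Real.sqrt (lossFwd (T s t) x) * Real.sqrt (lossAdj (T s t) ζ)) := by ring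
      _ ≤ (Cs + C₂ / Real.sqrt dF) * ((Cs + C₂ / Real.sqrt dF) * a + m')
            * (Real.sqrt (lossFwd (T s t) x) * Real.sqrt (lossAdj (T s t) ζ)) := mul_le_mul_of_nonneg_right hfac hqq
      _ = _ := by rw [ha_def, hm'_def]; ring
  · -- ### LONG ROW
    rw [not_le] at hshort
    set η : ℝ := C₂ * (C₂ * a + m') with hη
    have hη0 : 0 ≤ η := by rw [hη]; exact mul_nonneg hC₂ (by positivity)
    -- member facts
    have hLN : 2 * (n / 4) < n := by omega
    obtain ⟨lam, hlam, hA𝔸⟩ := hwin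
    obtain ⟨lam', hlam', hΦn⟩ := hΦw
    have hlam0 : 0 < lam := by linarith [hlam.1]
    have hlam'0 : 0 < lam' := by linarith [hlam'.1]
    have hcν : 0 ≤ c / ν := div_nonneg hc.le hν.1.le
    have hn2 : (0:ℝ) < 1 / (n:ℝ) ^ 2 := by positivity
    have hcell : Torus.NearIso ((1 / (n:ℝ) ^ 2) • 𝔸) ((1 / (n:ℝ) ^ 2) * (ν * (lo / lam))) ((1 / (n:ℝ) ^ 2) * (ν * (hi * lam))) :=
      hA𝔸.smul hn2.le
    have hcell_lo : 0 < (1 / (n:ℝ) ^ 2) * (ν * (lo / lam)) := mul_pos hn2 (mul_pos hν.1 (div_pos hlo hlam0))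
    have hcoarse0 : Torus.NearIso ((1 / (n:ℝ) ^ 2) • (𝔸 + (c / ν) • Φ ν ((1 / ν) • 𝔸)))
        ((1 / (n:ℝ) ^ 2) * (ν * (lo / lam) + (c / ν) * (lo / lam'))) ((1 / (n:ℝ) ^ 2) * (ν * (hi * lam) + (c / ν) * (hi * lam'))) :=
      (hA𝔸.add (hΦn.smul hcν)).smul hn2.le
    have hcoarse0_lo : 0 < (1 / (n:ℝ) ^ 2) * (ν * (lo / lam) + (c / ν) * (lo / lam')) := by
      have h1 : 0 < ν * (lo / lam) := mul_pos hν.1 (div_pos hlo hlam0)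
      have h2 : 0 ≤ (c / ν) * (lo / lam') := mul_nonneg hcν (div_pos hlo hlam'0).le
      exact mul_pos hn2 (by linarith)
    have hloT_le : loT lo Λ c ν n ≤ (1 / (n:ℝ) ^ 2) * (ν * (lo / lam) + (c / ν) * (lo / lam')) := by
      unfold loT
      have h1 : lo / Λ ≤ lo / lam := div_le_div_of_nonneg_left hlo.le hlam0 hlam.2
      have h2 : lo / Λ ≤ lo / lam' := div_le_div_of_nonneg_left hlo.le hlam'0 hlam'.2
      have h3 : (ν + c / ν) * (lo / Λ) ≤ ν * (lo / lam) + (c / ν) * (lo / lam') := by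
        have := mul_le_mul_of_nonneg_left h1 hν.1.le
        have := mul_le_mul_of_nonneg_left h2 hcν
        nlinarith
      exact mul_le_mul_of_nonneg_left h3 hn2.le
    have hloT : 0 < loT lo Λ c ν n := by
      unfold loT
      have hνc : 0 < ν + c / ν := by have := hν.1; positivity
      exact mul_pos hn2 (mul_pos hνc (div_pos hlo hΛ0))
    have hcoarse : Torus.NearIso ((1 / (n:ℝ) ^ 2) • (𝔸 + (c / ν) • Φ ν ((1 / ν) • 𝔸)))
        (loT lo Λ c ν n) ((1 / (n:ℝ) ^ 2) * (ν * (hi * lam) + (c / ν) * (hi * lam'))) := hcoarse0.mono hloT_le le_rfl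
    have hbU : MemLp (Torus.stLift (cellField W M hM ν hν.1 n)) ∞ (volume.restrict (Ioo 0 Tw ×ˢ (univ : Set (EuclideanSpace ℝ (Fin 3))))) :=
      memLp_top_stLift_cell _ n Tw
    have hbUdiv : ∀ᵐ τ ∂(volume.restrict (Ioo (0:ℝ) Tw)), Torus.IsWeaklyDivFree (cellField W M hM ν hν.1 n τ) :=
      ae_of_all _ fun τ => (isDivFree_cell _ n τ).isWeaklyDivFree_holds (isSmooth_cell _ n τ)
    have hbT : MemLp (Torus.stLift (fun (_ : ℝ) (_ : UnitAddTorus (Fin 3)) => (0 : EuclideanSpace ℝ (Fin 3)))) ∞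
        (volume.restrict (Ioo 0 Tw ×ˢ (univ : Set (EuclideanSpace ℝ (Fin 3))))) := memLp_top_const 0
    have hbTdiv : ∀ᵐ τ ∂(volume.restrict (Ioo (0:ℝ) Tw)),
        Torus.IsWeaklyDivFree ((fun (_ : ℝ) (_ : UnitAddTorus (Fin 3)) => (0 : EuclideanSpace ℝ (Fin 3))) τ) :=
      ae_of_all _ fun τ θ hθ => by simp
    have hgrid : ∀ (j : Fin 3 → Fin n) (τ : ℝ) (y : UnitAddTorus (Fin 3)),
        cellField W M hM ν hν.1 n τ (y + (fun i => ((((j i : ℕ) : ℝ) / n : ℝ) : UnitAddCircle))) = cellField W M hM ν hν.1 n τ y :=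
      fun j τ y => by unfold cellField; exact cell_add_grid _ hnpos j τ y
    have hsupp := coarseSupp Tw _ _ _ hcoarse0_lo hcoarse0 T hT s t hs hst.le htT
    -- ### the zero-mode split of the datum
    set A0 : Set (Fin 3 → ℤ) := {0} with hA0
    obtain ⟨P0, hP0⟩ := exists_labelProj A0 (fun k' => by rw [hA0]; simp)
    have hP0on : ∀ y : V2, fc (P0 y) 0 = fc y 0 := fun y => by have h := hP0 y 0; rw [if_pos (by rw [hA0]; simp)] at h; exact h
    have hP0off : ∀ (y : V2) k', k' ≠ 0 → fc (P0 y) k' = 0 := fun y k' hk' => by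
      have h := hP0 y k'; rw [if_neg (by rw [hA0]; simpa using hk')] at h; exact h
    set x₀ : V2 := P0 x with hx₀
    set x' : V2 := x - P0 x with hx'
    have hxsplit : x = x₀ + x' := by rw [hx₀, hx']; abel
    have hx'nz : IsSlowNZ n x' := by
      intro k' hk'
      rw [hx', fc_sub]
      by_cases h0 : k' = 0
      · subst h0; rw [hP0on, sub_self]
      · rw [hP0off x k' h0, sub_zero]
        exact hx k' fun hmem => hk' (Finset.mem_erase.2 ⟨h0, hmem⟩)
    have hx'0 : fc x' 0 = 0 := hx'nz 0 (by simp)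
    have hUx₀ : U s t x₀ = x₀ := apply_eq_self_of_supp_zero hcell hcell_lo hbU hbUdiv hU hs hst.le htT x₀ (hP0off x)
    have hTx₀ : T s t x₀ = x₀ := apply_eq_self_of_supp_zero hcoarse0 hcoarse0_lo hbT hbTdiv hT hs hst.le htT x₀ (hP0off x)
    have e1 : U s t x - T s t x = U s t x' - T s t x' := by
      rw [hxsplit, map_add, map_add, hUx₀, hTx₀]; abel
    -- losses only grow: `q_T(x') ≤ q_T(x)`
    have hTx'0 : fc (T s t x') 0 = 0 := (hsupp x' 0 hx'0).1
    have hox : ⟪x₀, x'⟫_ℝ = 0 := inner_eq_zero_of_fc_disjoint fun k' => by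
      by_cases h0 : k' = 0
      · subst h0; exact Or.inr hx'0
      · exact Or.inl (hP0off x k' h0)
    have hoTx : ⟪T s t x₀, T s t x'⟫_ℝ = 0 := inner_eq_zero_of_fc_disjoint fun k' => by
      by_cases h0 : k' = 0
      · subst h0; exact Or.inr hTx'0
      · exact Or.inl ((hsupp x₀ k' (hP0off x k' h0)).1)
    have hq : lossFwd (T s t) x' ≤ lossFwd (T s t) x := by
      have hadd : lossFwd (T s t) x = lossFwd (T s t) x₀ + lossFwd (T s t) x' := by
        unfold lossFwd; rw [hxsplit]; exact loss_add_of_orthogonal hox hoTx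
      have h0 : 0 ≤ lossFwd (T s t) x₀ := loss_nonneg hTc x₀
      rw [hadd]; linarith
    -- ### the (sf) assembly on the nonzero slow part
    set S : Finset (Fin 3 → ℤ) := (Torus.freqBall (d := Fin 3) (n / 4)).erase 0 with hS
    set Z : Set (Fin 3 → ℤ) := ↑(Torus.freqBall (d := Fin 3) (n / 4)) with hZ
    have hSneg : ∀ k' ∈ S, -k' ∈ S := fun k' hk' => by
      rw [hS, Finset.mem_erase] at hk' ⊢
      exact ⟨neg_ne_zero.2 hk'.1, (Torus.neg_mem_freqBall).2 hk'.2⟩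
    have halone : ∀ ℓ ∈ S, ∀ k' ∈ S, ((∀ i, (n:ℤ) ∣ k' i - ℓ i) ∨ (∀ i, (n:ℤ) ∣ k' i + ℓ i)) → k' = ℓ ∨ k' = -ℓ :=
      fun ℓ hℓ k' hk' hpair => FlatWindow.alone_of_lt hLN (Finset.mem_of_mem_erase hℓ) (Finset.mem_of_mem_erase hk') hpair
    have hnsc : ∀ ℓ ∈ S, ¬ (∀ i, (n:ℤ) ∣ ℓ i + ℓ i) :=
      fun ℓ hℓ => FlatWindow.not_selfConj_of_lt hLN (Finset.mem_of_mem_erase hℓ) (Finset.ne_of_mem_erase hℓ)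
    have hSZ : ∀ k' ∈ S, k' ∈ Z := fun k' hk' => by rw [hZ, Finset.mem_coe]; exact Finset.mem_of_mem_erase hk'
    have hUcl : ∀ (c' : Fin 3 → ℤ) (y : V2), (∀ k', ((∀ i, (n:ℤ) ∣ k' i - c' i) ∨ (∀ i, (n:ℤ) ∣ k' i + c' i)) →
          mFourierCoeff (EuclideanSpace.complexify ∘ ⇑y) k' = 0) →
        ∀ k', ((∀ i, (n:ℤ) ∣ k' i - c' i) ∨ (∀ i, (n:ℤ) ∣ k' i + c' i)) →
          mFourierCoeff (EuclideanSpace.complexify ∘ ⇑(U s t y)) k' = 0 :=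
      fun c' y hy k' hk' => PropagatorSymm.fcoeff_apply_eq_zero_of_classes hU hcell hcell_lo hbU hbUdiv hnpos hgrid c' hs hst.le htT y hy k' hk'
    have hTmode : ∀ (y : V2) (k' : Fin 3 → ℤ), mFourierCoeff (EuclideanSpace.complexify ∘ ⇑y) k' = 0 →
        mFourierCoeff (EuclideanSpace.complexify ∘ ⇑(T s t y)) k' = 0 := fun y k' hy => (hsupp y k' hy).1
    -- the weights
    set dd : (Fin 3 → ℤ) → ℝ := fun ℓ => dW lo Λ c ν n (t - s) ℓ with hdd
    have hdd0 : ∀ ℓ, 0 ≤ dd ℓ := fun ℓ => by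
      rw [hdd]; unfold dW
      have : Real.exp (-(8 * Real.pi ^ 2 * loT lo Λ c ν n * Torus.freqNormSq ℓ * (t - s))) ≤ 1 := by
        apply Real.exp_le_one_iff.2
        have := Real.pi_pos; have := Torus.freqNormSq_nonneg ℓ
        have : 0 ≤ 8 * Real.pi ^ 2 * loT lo Λ c ν n * Torus.freqNormSq ℓ * (t - s) := by positivity
        linarith
      linarith
    -- the sideband hypothesis from the text
    have hsb : ∀ ℓ ∈ S, ∀ w : V2, w ∈ Torus.divFreeL2 (Fin 3) →
        (∀ k', k' ≠ ℓ → k' ≠ -ℓ → mFourierCoeff (EuclideanSpace.complexify ∘ ⇑w) k' = 0) →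
        ∀ y : V2, (∀ k' ∈ Z, mFourierCoeff (EuclideanSpace.complexify ∘ ⇑y) k' = 0) →
          |⟪U s t w, y⟫_ℝ| ≤ (η * Real.sqrt (dd ℓ)) * ‖w‖ * ‖y‖ := by
      intro ℓ hℓ w hw hws y hy
      have hyf : IsFast n y := fun k' hk' => hy k' (by rw [hZ, Finset.mem_coe]; exact hk')
      have h := hmode ν hν n hn 𝔸 hodd ⟨lam, hlam, hA𝔸⟩ hΦo ⟨lam', hlam', hΦn⟩ Tw hTw U T hU hT s t hs hst htT hshort ℓ hℓ w hw hws y hyf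
      rw [hη, ha_def, hm'_def, hdd]
      exact h
    have key := abs_inner_sub_le_sqrt_of_slow_sideband S Z (U s t) (T s t) (fun ℓ => η * Real.sqrt (dd ℓ)) hnpos hSneg halone hnsc
      (fun ℓ => mul_nonneg hη0 (Real.sqrt_nonneg _)) hSZ (fun y => hU.apply_eq_apply_starProjection s t y) hUcl hTmode hsb
      dd η hη0 hdd0 (fun ℓ _ => le_rfl) x' ζ hx'nz (fun k' hk' => hζ k' (by rw [hZ, Finset.mem_coe] at hk'; exact hk'))
    -- ### the currencies
    have hF : ∑ k' ∈ S, dd k' * ‖mFourierCoeff (EuclideanSpace.complexify ∘ ⇑x') k'‖ ^ 2 ≤ lossFwd (T s t) x :=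
      (sum_weight_le_lossFwd hcoarse hloT (fun _ _ => rfl) hT hs hst.le htT S x').trans hq
    -- the fast test: `d_F‖ζ‖² ≤ q*_T(ζ)`
    set mF : ℝ := (((n / 4 : ℕ) : ℝ)) ^ 2 + 1 with hmF
    have hmF0 : 0 ≤ mF := by positivity
    have hζsupp : ∀ k', fc ζ k' ≠ 0 → mF ≤ Torus.freqNormSq k' := fun k' hk' =>
      freqNormSq_ge_of_not_mem_freqBall fun hmem => hk' (hζ k' hmem)
    have hA := lossAdj_ge_of_supp hcoarse hloT hT hs hst.le htT ζ hmF0 hζsupp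
    have hexp : rF ≤ 8 * Real.pi ^ 2 * loT lo Λ c ν n * mF * (t - s) := by
      -- `loT·mF ≥ ν(lo/Λ)/256` and `ν(t−s) > M·W.period`
      have h1 : (n:ℝ) ^ 2 / 256 ≤ mF := sq_div_le_quarter_sq_add_one n
      have h2 : ν * (lo / Λ) / 256 ≤ loT lo Λ c ν n * mF := by
        unfold loT
        have hνc : ν ≤ ν + c / ν := by linarith
        have hloΛ : 0 ≤ lo / Λ := (div_pos hlo hΛ0).le
        calc ν * (lo / Λ) / 256 = (1 / (n:ℝ) ^ 2 * (ν * (lo / Λ))) * ((n:ℝ) ^ 2 / 256) := by field_simp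
          _ ≤ (1 / (n:ℝ) ^ 2 * ((ν + c / ν) * (lo / Λ))) * mF :=
              mul_le_mul (mul_le_mul_of_nonneg_left (mul_le_mul_of_nonneg_right hνc hloΛ) hn2.le) h1 (by positivity)
                (by positivity)
      have h3 : M * W.period < ν * (t - s) := by
        have := (div_lt_iff₀ hν.1).1 (show M * W.period / ν < t - s from hshort)
        linarith
      have h4 : 0 ≤ loT lo Λ c ν n * mF := by positivity
      rw [hrF]
      have h5 : Real.pi ^ 2 * (lo / Λ) * (M * W.period) ≤ Real.pi ^ 2 * (lo / Λ) * (ν * (t - s)) :=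
        mul_le_mul_of_nonneg_left h3.le (by positivity)
      have h6 : Real.pi ^ 2 * (lo / Λ) * (ν * (t - s)) / 32 = 8 * Real.pi ^ 2 * (ν * (lo / Λ) / 256) * (t - s) := by ring
      have h7 : 8 * Real.pi ^ 2 * (ν * (lo / Λ) / 256) * (t - s) ≤ 8 * Real.pi ^ 2 * (loT lo Λ c ν n * mF) * (t - s) :=
        mul_le_mul_of_nonneg_right (mul_le_mul_of_nonneg_left h2 (by positivity)) hτ.le
      calc Real.pi ^ 2 * (lo / Λ) * (M * W.period) / 32 ≤ Real.pi ^ 2 * (lo / Λ) * (ν * (t - s)) / 32 := by linarith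
        _ = 8 * Real.pi ^ 2 * (ν * (lo / Λ) / 256) * (t - s) := h6
        _ ≤ 8 * Real.pi ^ 2 * (loT lo Λ c ν n * mF) * (t - s) := h7
        _ = 8 * Real.pi ^ 2 * loT lo Λ c ν n * mF * (t - s) := by ring
    have hdFle : dF ≤ 1 - Real.exp (-(8 * Real.pi ^ 2 * loT lo Λ c ν n * mF * (t - s))) := by
      rw [hdF]
      have := Real.exp_le_exp.2 (neg_le_neg hexp)
      linarith
    have hζcur : dF * ‖ζ‖ ^ 2 ≤ lossAdj (T s t) ζ :=
      (mul_le_mul_of_nonneg_right hdFle (sq_nonneg _)).trans hA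
    have hζnorm : ‖ζ‖ ≤ Real.sqrt (lossAdj (T s t) ζ) / Real.sqrt dF := by
      rw [le_div_iff₀ hsdF, ← Real.sqrt_sq (norm_nonneg ζ), ← Real.sqrt_mul (sq_nonneg _)]
      exact Real.sqrt_le_sqrt (by linarith [mul_comm dF (‖ζ‖ ^ 2)])
    -- ### conclusion
    rw [e1]
    refine key.trans ?_
    have h1 := Real.sqrt_le_sqrt hF
    calc η * Real.sqrt (∑ k' ∈ S, dd k' * ‖mFourierCoeff (EuclideanSpace.complexify ∘ ⇑x') k'‖ ^ 2) * ‖ζ‖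
        ≤ η * Real.sqrt (lossFwd (T s t) x) * (Real.sqrt (lossAdj (T s t) ζ) / Real.sqrt dF) :=
          mul_le_mul (mul_le_mul_of_nonneg_left h1 hη0) hζnorm (norm_nonneg _) (by positivity)
      _ = (η / Real.sqrt dF) * Real.sqrt (lossFwd (T s t) x) * Real.sqrt (lossAdj (T s t) ζ) := by ring
      _ ≤ ((Cs + C₂ / Real.sqrt dF) * ((Cs + C₂ / Real.sqrt dF) * a + m'))
            * Real.sqrt (lossFwd (T s t) x) * Real.sqrt (lossAdj (T s t) ζ) := by
          have hfac : η / Real.sqrt dF ≤ (Cs + C₂ / Real.sqrt dF) * ((Cs + C₂ / Real.sqrt dF) * a + m') := by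
            rw [hη]; exact allowance_div_sqrt_le hCs0 hC₂ hdF0 hdF1 ha0 hm'0
          gcongr
      _ = _ := by rw [ha_def, hm'_def]

end Summit.AnomalousDissipation.AnomalousDissipation.Theorems.SolenoidalFractalHomogenisation.LagrangianStep.VmodFlat

end
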